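import Literature.NumberTheory.EllipticCurves.WeierstrassZeta
import Literature.NumberTheory.EllipticCurves.RealLatticePeriod
import Mathlib.NumberTheory.LSeries.HurwitzZetaEven
import Mathlib.Analysis.Normed.Group.Tannery
import HarnessLib

/-!
# Gauss-damped Eisenstein summation of weight one on the Gaussian lattice `ℤi + ℤ`

Topic `Literature/NumberTheory/EllipticCurves` (complex-lattice cluster: `WeierstrassZeta`,
`EisensteinValuesAtI`). For the Gaussian lattice `Λ = ℤi + ℤ`
(`PeriodPair.ofUpperHalfPlane UpperHalfPlane.I`, covolume `1`) and any `z ∈ ℂ` we prove the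
**Kronecker limit formula of weight one in Gaussian regularisation**:

  `lim_{y → 0⁺} ∑_{l ∈ Λ} e^{-y |z - l|²} / (z - l) = ζ_Λ(z) - π z̄`

(`tendsto_tsum_exp_div_sub`), where `ζ_Λ` is the Weierstrass zeta function of `Λ`
(`PeriodPair.weierstrassZeta`). The conditionally convergent lattice sum `∑ 1/(z - l)`, summed
with the Gaussian weight centred at the point `z` itself (equivalently: by expanding discs
centred at `z`, as the Dirichlet series `∑_{α ≡ α₀ (𝔪)} ᾱ^{-1} |α|^{-2(s-1)}` of a Hecke character
of `ℚ(i)` does at `s = 1`), differs from the absolutely convergent Weierstrass series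
`ζ(z) = 1/z + ∑' (1/(z-l) + 1/l + z/l²)` by the anomaly `-π z̄ / covol(Λ)`; this is the
non-holomorphic term of the Eisenstein–Kronecker series `E₁*(z, Λ) = ζ(z) - s₂(Λ) z - π z̄/A(Λ)`
(with `s₂ = 0` for the square lattice), cf. Weil, *Elliptic functions according to Eisenstein
and Kronecker*, Ch. VI–VIII, and Birch–Swinnerton-Dyer, *Notes on elliptic curves II* (1965), §3,
where `L_D(1)` for `y² = x³ - Dx` is evaluated through exactly such sums. With
`GaussianThetaLValueOne` (the value at `s = 1` of a weight-one theta `L`-series of `ℤ[i]` as the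
same Gauss-damped limit) it reduces `L(E_n, 1)` for the congruent number curves to finitely many
values of `ζ_{ℤi+ℤ}` at division points.

## Proof

Write `e^{-y|z-l|²} = e^{-y|z|²} e^{-y|l|²} e^{u_l}`, `u_l = y (z l̄ + z̄ l) ∈ ℝ`, and
`1/(z-l) = g(l) - h(l)` with `g(l) = 1/(z-l) + 1/l + z/l²` (the zeta summand, `O(|l|⁻³)`) and
`h(l) = 1/l + z/l²`.
* `∑ e^{-y|z-l|²} g(l) → ∑ g(l) = ζ(z)` by dominated convergence (Tannery).
* In `∑ e^{-y|z-l|²} h(l)`, expand `e^{u} = 1 + u + ρ(u)`, `0 ≤ ρ(u) ≤ u² e^{|u|}`. The rotation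
  `l ↦ il` of `Λ` preserves `e^{-y|l|²}` and multiplies `1/l`, `1/l²`, `l̄/l`, `l̄/l²` by constants
  `≠ 1`, so the Gauss-weighted sums of these four functions vanish; what survives of the
  first-order term is `y z̄ ∑_{l ≠ 0} e^{-y|l|²}`, and `y ∑_{l ∈ Λ} e^{-y|l|²} → π` (the square of
  Jacobi's `√x θ(x) → 1`, Mathlib's `evenKernel_functional_equation`). The `ρ`-term is
  `O(y² ∑ |l| e^{-y|l|²/2}) = O(√y)`.

Everything is proved; there are no new definitions and no named facts.

## References

* A. Weil, *Elliptic Functions according to Eisenstein and Kronecker*, Springer 1976, Ch. VIII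
  (Kronecker's limit formulas; `E₁*`).
* B. J. Birch, H. P. F. Swinnerton-Dyer, *Notes on elliptic curves. II*, J. reine angew. Math.
  218 (1965) 79–108, §3.
-/

noncomputable section

open UpperHalfPlane hiding I
open Complex Real Filter Topology Asymptotics PeriodPair HurwitzZeta
open scoped ComplexConjugate

namespace Literature.NumberTheory.EllipticCurves

namespace GaussianLattice

/-! ### The lattice `ℤi + ℤ`: parametrisation, norms, rotation by `i` -/

/-- The points of `Λ = ℤi + ℤ` through Mathlib's `latticeEquivProd`: `(m, n) ↦ m i + n`.
[folklore] -/
theorem coe_latticeEquivProd_symm (p : ℤ × ℤ) :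
    (((ofUpperHalfPlane UpperHalfPlane.I).latticeEquivProd.symm p :
      (ofUpperHalfPlane UpperHalfPlane.I).lattice) : ℂ) = (p.1 : ℂ) * I + p.2 := by
  rw [latticeEquiv_symm_apply]
  simp

/-- `|m i + n|² = m² + n²`. [folklore] -/
theorem norm_sq_intCast_mul_I_add (m n : ℤ) :
    ‖(m : ℂ) * I + n‖ ^ 2 = (m : ℝ) ^ 2 + (n : ℝ) ^ 2 := by
  rw [Complex.sq_norm, Complex.normSq_apply]
  simp
  ring

/-- Every `l ∈ ℤi + ℤ` is `m i + n` with `(m, n) = latticeEquivProd l`. [folklore] -/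
theorem coe_eq_of_lattice (l : (ofUpperHalfPlane UpperHalfPlane.I).lattice) :
    (l : ℂ) = (((ofUpperHalfPlane UpperHalfPlane.I).latticeEquivProd l).1 : ℂ) * I +
      ((ofUpperHalfPlane UpperHalfPlane.I).latticeEquivProd l).2 := by
  conv_lhs => rw [← (ofUpperHalfPlane UpperHalfPlane.I).latticeEquivProd.symm_apply_apply l]
  exact coe_latticeEquivProd_symm _

/-- `‖l‖² = m² + n²` for `l = m i + n ∈ Λ`. [folklore] -/
theorem norm_sq_eq_of_lattice (l : (ofUpperHalfPlane UpperHalfPlane.I).lattice) :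
    ‖(l : ℂ)‖ ^ 2 = (((ofUpperHalfPlane UpperHalfPlane.I).latticeEquivProd l).1 : ℝ) ^ 2 +
      (((ofUpperHalfPlane UpperHalfPlane.I).latticeEquivProd l).2 : ℝ) ^ 2 := by
  rw [coe_eq_of_lattice l, norm_sq_intCast_mul_I_add]

/-- Nonzero points of `ℤi + ℤ` have norm at least `1`. [folklore] -/
theorem one_le_norm_of_ne_zero {l : (ofUpperHalfPlane UpperHalfPlane.I).lattice}
    (hl : (l : ℂ) ≠ 0) : 1 ≤ ‖(l : ℂ)‖ := by
  set p := (ofUpperHalfPlane UpperHalfPlane.I).latticeEquivProd l with hp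
  have hsq := norm_sq_eq_of_lattice l
  have hp0 : p ≠ 0 := by
    intro h0
    apply hl
    rw [coe_eq_of_lattice l, ← hp, h0]
    simp
  have h1 : (1 : ℝ) ≤ (p.1 : ℝ) ^ 2 + (p.2 : ℝ) ^ 2 := by
    rcases ne_or_eq p.1 0 with h | h
    · have : (1 : ℝ) ≤ (p.1 : ℝ) ^ 2 := by
        have h' : 1 ≤ |(p.1 : ℝ)| := by exact_mod_cast Int.one_le_abs h
        nlinarith [sq_abs (p.1 : ℝ)]
      nlinarith [sq_nonneg (p.2 : ℝ)]
    · have h2 : p.2 ≠ 0 := fun h2 ↦ hp0 (Prod.ext h h2)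
      have : (1 : ℝ) ≤ (p.2 : ℝ) ^ 2 := by
        have h' : 1 ≤ |(p.2 : ℝ)| := by exact_mod_cast Int.one_le_abs h2
        nlinarith [sq_abs (p.2 : ℝ)]
      nlinarith [sq_nonneg (p.1 : ℝ)]
  rw [← hp] at hsq
  nlinarith [norm_nonneg (l : ℂ), hsq]

/-- `i Λ ⊆ Λ`: `i (m i + n) = n i - m`. [folklore] -/
theorem I_mul_mem_lattice {w : ℂ} (hw : w ∈ (ofUpperHalfPlane UpperHalfPlane.I).lattice) :
    I * w ∈ (ofUpperHalfPlane UpperHalfPlane.I).lattice := by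
  obtain ⟨p, rfl⟩ : ∃ p : ℤ × ℤ,
      (((ofUpperHalfPlane UpperHalfPlane.I).latticeEquivProd.symm p :
        (ofUpperHalfPlane UpperHalfPlane.I).lattice) : ℂ) = w :=
    ⟨(ofUpperHalfPlane UpperHalfPlane.I).latticeEquivProd ⟨w, hw⟩, by simp⟩
  rw [coe_latticeEquivProd_symm]
  have h := ((ofUpperHalfPlane UpperHalfPlane.I).latticeEquivProd.symm (p.2, -p.1)).2
  rw [show (((ofUpperHalfPlane UpperHalfPlane.I).latticeEquivProd.symm (p.2, -p.1) :
      (ofUpperHalfPlane UpperHalfPlane.I).lattice) : ℂ) = (p.2 : ℂ) * I + ((-p.1 : ℤ) : ℂ) from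
    coe_latticeEquivProd_symm _] at h
  convert h using 1
  push_cast
  ring_nf
  rw [I_sq]
  ring

/-- **Rotation by `i` is a bijection of `Λ = ℤi + ℤ`** (as an `Equiv` on the lattice, acting by
`l ↦ i l` on the underlying complex numbers). [folklore] -/
theorem exists_equiv_I_mul :
    ∃ e : (ofUpperHalfPlane UpperHalfPlane.I).lattice ≃ (ofUpperHalfPlane UpperHalfPlane.I).lattice,
      ∀ l, ((e l : (ofUpperHalfPlane UpperHalfPlane.I).lattice) : ℂ) = I * l := by
  refine ⟨{ toFun := fun l ↦ ⟨I * l, I_mul_mem_lattice l.2⟩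
            invFun := fun l ↦ ⟨-I * l, by
              have h := I_mul_mem_lattice (I_mul_mem_lattice (I_mul_mem_lattice l.2))
              have h3 : I * (I * (I * (l : ℂ))) = -I * l := by
                rw [← mul_assoc, ← mul_assoc, I_mul_I]
                ring
              rwa [h3] at h⟩
            left_inv := fun l ↦ by
              apply Subtype.ext
              simp only
              ring_nf
              rw [I_sq]
              ring
            right_inv := fun l ↦ by
              apply Subtype.ext
              simp only
              ring_nf
              rw [I_sq]
              ring }, fun l ↦ rfl⟩

/-- **Vanishing by rotation**: if `F(i w) = c F(w)` with `c ≠ 1` then `∑_{l ∈ Λ} F(l) = 0`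
(unconditionally, as a `tsum`). [folklore] -/
theorem tsum_lattice_eq_zero_of_I_mul {F : ℂ → ℂ} {c : ℂ} (hc : c ≠ 1)
    (hF : ∀ w, F (I * w) = c * F w) :
    ∑' l : (ofUpperHalfPlane UpperHalfPlane.I).lattice, F l = 0 := by
  obtain ⟨e, he⟩ := exists_equiv_I_mul
  have h1 : ∑' l : (ofUpperHalfPlane UpperHalfPlane.I).lattice, F l =
      ∑' l : (ofUpperHalfPlane UpperHalfPlane.I).lattice, F (e l) :=
    (e.tsum_eq (fun l ↦ F l)).symm
  simp_rw [he, hF, tsum_mul_left] at h1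
  have h2 : (1 - c) * ∑' l : (ofUpperHalfPlane UpperHalfPlane.I).lattice, F l = 0 := by
    rw [sub_mul, one_mul, ← h1, sub_self]
  exact (mul_eq_zero.mp h2).resolve_left (sub_ne_zero.mpr hc.symm)

/-- The four Gauss-weighted symmetric sums that vanish on `ℤi + ℤ`: `∑ e^{-y|l|²}/l`,
`∑ e^{-y|l|²}/l²`, `∑ e^{-y|l|²} l̄/l`, `∑ e^{-y|l|²} l̄/l²` (the rotation `l ↦ il` multiplies the
summands by `-i`, `-1`, `-1`, `i`). [folklore] -/
theorem tsum_exp_mul_eq_zero (y : ℝ) :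
    (∑' l : (ofUpperHalfPlane UpperHalfPlane.I).lattice,
        (rexp (-y * ‖(l : ℂ)‖ ^ 2) : ℂ) / l = 0) ∧
    (∑' l : (ofUpperHalfPlane UpperHalfPlane.I).lattice,
        (rexp (-y * ‖(l : ℂ)‖ ^ 2) : ℂ) / (l : ℂ) ^ 2 = 0) ∧
    (∑' l : (ofUpperHalfPlane UpperHalfPlane.I).lattice,
        (rexp (-y * ‖(l : ℂ)‖ ^ 2) : ℂ) * conj (l : ℂ) / l = 0) ∧
    (∑' l : (ofUpperHalfPlane UpperHalfPlane.I).lattice,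
        (rexp (-y * ‖(l : ℂ)‖ ^ 2) : ℂ) * conj (l : ℂ) / (l : ℂ) ^ 2 = 0) := by
  have hn : ∀ w : ℂ, ‖I * w‖ = ‖w‖ := fun w ↦ by rw [norm_mul, Complex.norm_I, one_mul]
  refine ⟨?_, ?_, ?_, ?_⟩
  · refine tsum_lattice_eq_zero_of_I_mul (F := fun w ↦ (rexp (-y * ‖w‖ ^ 2) : ℂ) / w)
      (c := -I) (by intro h; have := congrArg Complex.im h; simp at this) fun w ↦ ?_
    simp only [hn, div_eq_mul_inv, mul_inv, Complex.inv_I]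
    ring
  · refine tsum_lattice_eq_zero_of_I_mul (F := fun w ↦ (rexp (-y * ‖w‖ ^ 2) : ℂ) / w ^ 2)
      (c := -1) (by norm_num) fun w ↦ ?_
    simp only [hn, div_eq_mul_inv, mul_pow, I_sq, mul_inv, inv_neg, inv_one]
    ring
  · refine tsum_lattice_eq_zero_of_I_mul
      (F := fun w ↦ (rexp (-y * ‖w‖ ^ 2) : ℂ) * conj w / w)
      (c := -1) (by norm_num) fun w ↦ ?_
    simp only [hn, map_mul, Complex.conj_I, div_eq_mul_inv, mul_inv, Complex.inv_I]
    ring_nf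
    rw [I_sq]
    ring
  · refine tsum_lattice_eq_zero_of_I_mul
      (F := fun w ↦ (rexp (-y * ‖w‖ ^ 2) : ℂ) * conj w / w ^ 2)
      (c := I) (by intro h; have := congrArg Complex.im h; simp at this) fun w ↦ ?_
    simp only [hn, map_mul, Complex.conj_I, div_eq_mul_inv, mul_pow, I_sq, mul_inv, inv_neg,
      inv_one]
    ring

/-! ### Gaussian sums: `y ∑_{l ∈ Λ} e^{-y|l|²} → π` -/

/-- `y ↦ y / c` maps `0⁺` to `0⁺` for `c > 0`. [folklore] -/
theorem tendsto_div_const_nhdsGT_zero {c : ℝ} (hc : 0 < c) :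
    Tendsto (fun y : ℝ ↦ y / c) (𝓝[>] 0) (𝓝[>] 0) := by
  refine tendsto_nhdsWithin_iff.mpr ⟨?_, ?_⟩
  · have h : Tendsto (fun y : ℝ ↦ y / c) (𝓝 0) (𝓝 (0 / c)) :=
      (continuous_id.div_const c).tendsto 0
    rw [zero_div] at h
    exact h.mono_left nhdsWithin_le_nhds
  · filter_upwards [self_mem_nhdsWithin] with y (hy : 0 < y)
    exact Set.mem_Ioi.mpr (div_pos hy hc)

/-- **Jacobi: `√x · θ(x) → 1` as `x → 0⁺`** for `θ(x) = ∑_{m ∈ ℤ} e^{-π m² x}` (Mathlib's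
`evenKernel 0`; from `θ(x) = x^{-1/2} θ(1/x)` and `θ(u) → 1` as `u → ∞`). [folklore] -/
theorem tendsto_sqrt_mul_evenKernel_zero :
    Tendsto (fun x : ℝ ↦ Real.sqrt x * evenKernel ((0 : ℝ) : UnitAddCircle) x) (𝓝[>] 0)
      (𝓝 1) := by
  obtain ⟨p, hp, hO⟩ := isBigO_atTop_cosKernel_sub ((0 : ℝ) : UnitAddCircle)
  have h0 : Tendsto (fun u : ℝ ↦ cosKernel ((0 : ℝ) : UnitAddCircle) u - 1) atTop (𝓝 0) := by
    refine hO.trans_tendsto ?_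
    have h3 : Tendsto (fun u : ℝ ↦ p * u) atTop atTop := Tendsto.const_mul_atTop hp tendsto_id
    have h := Real.tendsto_exp_neg_atTop_nhds_zero.comp h3
    refine h.congr fun u ↦ ?_
    simp only [Function.comp_apply, neg_mul]
  have h1 : Tendsto (fun u : ℝ ↦ cosKernel ((0 : ℝ) : UnitAddCircle) u) atTop (𝓝 1) := by
    have := h0.add_const 1
    simpa using this
  have h2 : Tendsto (fun x : ℝ ↦ cosKernel ((0 : ℝ) : UnitAddCircle) (1 / x)) (𝓝[>] 0)
      (𝓝 1) := by
    refine h1.comp ?_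
    exact (tendsto_inv_nhdsGT_zero (𝕜 := ℝ)).congr fun x ↦ (one_div x).symm
  refine h2.congr' ?_
  filter_upwards [self_mem_nhdsWithin] with x (hx : 0 < x)
  rw [evenKernel_functional_equation, ← mul_assoc, Real.sqrt_eq_rpow, one_div (x ^ (1 / 2 : ℝ)),
    mul_inv_cancel₀ (Real.rpow_pos_of_pos hx _).ne', one_mul]

/-- `θ(y/π) = ∑_{m ∈ ℤ} e^{-y m²}` for `y > 0`. [folklore] -/
theorem hasSum_exp_neg_mul_sq {y : ℝ} (hy : 0 < y) :
    HasSum (fun m : ℤ ↦ rexp (-y * (m : ℝ) ^ 2)) (evenKernel ((0 : ℝ) : UnitAddCircle) (y / π)) := by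
  have h := hasSum_int_evenKernel 0 (t := y / π) (by positivity)
  refine h.congr_fun fun m ↦ ?_
  rw [add_zero]
  congr 1
  field_simp

/-- **`∑_{l ∈ ℤi+ℤ} e^{-y|l|²} = θ(y/π)²`** (the lattice Gaussian sum factors), `y > 0`. [folklore] -/
theorem hasSum_lattice_exp_neg_mul_norm_sq {y : ℝ} (hy : 0 < y) :
    HasSum (fun l : (ofUpperHalfPlane UpperHalfPlane.I).lattice ↦ rexp (-y * ‖(l : ℂ)‖ ^ 2))
      (evenKernel ((0 : ℝ) : UnitAddCircle) (y / π) ^ 2) := by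
  have h1 := hasSum_exp_neg_mul_sq hy
  have hs : Summable fun m : ℤ ↦ ‖rexp (-y * (m : ℝ) ^ 2)‖ := by
    simpa only [Real.norm_eq_abs, abs_of_pos (Real.exp_pos _)] using h1.summable
  -- (no type ascription: the product shape `fun x ↦ f x.1 * g x.2` must come from `h1`)
  have hprod := h1.mul h1 (summable_mul_of_summable_norm hs hs)
  rw [sq]
  have h2 := ((ofUpperHalfPlane UpperHalfPlane.I).latticeEquivProd.toEquiv.hasSum_iff
    (f := fun p : ℤ × ℤ ↦ rexp (-y * (p.1 : ℝ) ^ 2) * rexp (-y * (p.2 : ℝ) ^ 2))).mpr hprod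
  refine h2.congr_fun fun l ↦ ?_
  simp only [Function.comp_apply, LinearEquiv.coe_toEquiv, ← Real.exp_add]
  congr 1
  rw [norm_sq_eq_of_lattice l]
  ring

/-- **`y ∑_{l ∈ ℤi+ℤ} e^{-y|l|²} → π` as `y → 0⁺`** (covolume `1`). [folklore] -/
theorem tendsto_mul_tsum_exp_neg_mul_norm_sq :
    Tendsto (fun y : ℝ ↦ y * ∑' l : (ofUpperHalfPlane UpperHalfPlane.I).lattice,
      rexp (-y * ‖(l : ℂ)‖ ^ 2)) (𝓝[>] 0) (𝓝 π) := by
  -- `y θ(y/π)² = π (√(y/π) θ(y/π))²`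
  have h1 : Tendsto (fun y : ℝ ↦ π * (Real.sqrt (y / π) *
      evenKernel ((0 : ℝ) : UnitAddCircle) (y / π)) ^ 2) (𝓝[>] 0) (𝓝 (π * 1 ^ 2)) := by
    refine Tendsto.const_mul π (Tendsto.pow ?_ 2)
    exact tendsto_sqrt_mul_evenKernel_zero.comp (tendsto_div_const_nhdsGT_zero Real.pi_pos)
  rw [one_pow, mul_one] at h1
  refine h1.congr' ?_
  filter_upwards [self_mem_nhdsWithin] with y (hy : 0 < y)
  rw [(hasSum_lattice_exp_neg_mul_norm_sq hy).tsum_eq, mul_pow,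
    Real.sq_sqrt (by positivity : 0 ≤ y / π)]
  field_simp

/-- The lattice Gaussian sum is summable (`y > 0`). [folklore] -/
theorem summable_lattice_exp_neg_mul_norm_sq {y : ℝ} (hy : 0 < y) :
    Summable fun l : (ofUpperHalfPlane UpperHalfPlane.I).lattice ↦ rexp (-y * ‖(l : ℂ)‖ ^ 2) :=
  (hasSum_lattice_exp_neg_mul_norm_sq hy).summable

/-- `y ∑ e^{-y|l|²}` is eventually at most `π + 1` as `y → 0⁺`. [folklore] -/
theorem eventually_mul_tsum_exp_le :
    ∀ᶠ y : ℝ in 𝓝[>] 0, y * ∑' l : (ofUpperHalfPlane UpperHalfPlane.I).lattice,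
      rexp (-y * ‖(l : ℂ)‖ ^ 2) ≤ π + 1 :=
  (tendsto_mul_tsum_exp_neg_mul_norm_sq.eventually (Iic_mem_nhds (by linarith)))


/-! ### Elementary estimates -/

/-- `0 ≤ e^u - 1 - u`. [folklore] -/
theorem exp_sub_one_sub_nonneg (u : ℝ) : 0 ≤ rexp u - 1 - u := by
  linarith [Real.add_one_le_exp u]

/-- **`e^u - 1 - u ≤ u² e^{|u|}`** for all real `u` (Taylor remainder, crude form). [folklore] -/
theorem exp_sub_one_sub_le (u : ℝ) : rexp u - 1 - u ≤ u ^ 2 * rexp |u| := by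
  have h1 : 1 ≤ rexp |u| := Real.one_le_exp (abs_nonneg u)
  rcases le_or_gt |u| 1 with hu | hu
  · calc rexp u - 1 - u ≤ |rexp u - 1 - u| := le_abs_self _
      _ ≤ u ^ 2 := Real.abs_exp_sub_one_sub_id_le hu
      _ ≤ u ^ 2 * rexp |u| := le_mul_of_one_le_right (sq_nonneg u) h1
  · have hu2 : 1 ≤ u ^ 2 := by nlinarith [sq_abs u]
    rcases le_or_gt 0 u with h0 | h0
    · rw [abs_of_nonneg h0] at h1 ⊢
      calc rexp u - 1 - u ≤ rexp u := by linarith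
        _ ≤ u ^ 2 * rexp u := le_mul_of_one_le_left (Real.exp_pos u).le hu2
    · have he : rexp u ≤ 1 := Real.exp_le_one_iff.mpr h0.le
      have hau : |u| = -u := abs_of_neg h0
      calc rexp u - 1 - u ≤ -u := by linarith
        _ ≤ u ^ 2 := by rw [← hau]; nlinarith [abs_nonneg u]
        _ ≤ u ^ 2 * rexp |u| := le_mul_of_one_le_right (sq_nonneg u) h1

/-- `t e^{-(y/4) t²} ≤ 2/√y` for `t ≥ 0`, `y > 0` (since `s ≤ 1 + s² ≤ e^{s²}`). [folklore] -/
theorem mul_exp_neg_le_two_div_sqrt {y t : ℝ} (hy : 0 < y) (ht : 0 ≤ t) :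
    t * rexp (-(y / 4) * t ^ 2) ≤ 2 / Real.sqrt y := by
  have hsy : 0 < Real.sqrt y := Real.sqrt_pos.mpr hy
  set s : ℝ := Real.sqrt y * t / 2 with hs
  have hs0 : 0 ≤ s := by positivity
  have hs2 : s ^ 2 = y / 4 * t ^ 2 := by
    rw [hs, div_pow, mul_pow, Real.sq_sqrt hy.le]; ring
  have h1 : s ≤ rexp (s ^ 2) := by
    have := Real.add_one_le_exp (s ^ 2)
    nlinarith [sq_nonneg (s - 1)]
  rw [hs2] at h1
  -- `√y t / 2 ≤ e^{(y/4) t²}`, i.e. `t e^{-(y/4)t²} ≤ 2/√y`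
  have hE := Real.exp_pos (-(y / 4) * t ^ 2)
  rw [le_div_iff₀ hsy]
  calc t * rexp (-(y / 4) * t ^ 2) * Real.sqrt y
      = 2 * (Real.sqrt y * t / 2) * rexp (-(y / 4) * t ^ 2) := by ring
    _ ≤ 2 * rexp (y / 4 * t ^ 2) * rexp (-(y / 4) * t ^ 2) := by gcongr
    _ = 2 := by rw [mul_assoc, ← Real.exp_add]; simp

/-- `‖a - b‖²`-comparison: `‖l‖² ≤ 2 ‖z - l‖² + 2 ‖z‖²`. [folklore] -/
theorem norm_sq_le_two_mul (z l : ℂ) : ‖l‖ ^ 2 ≤ 2 * ‖z - l‖ ^ 2 + 2 * ‖z‖ ^ 2 := by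
  have h : ‖l‖ ≤ ‖z‖ + ‖z - l‖ := by
    calc ‖l‖ = ‖z - (z - l)‖ := by rw [sub_sub_cancel]
      _ ≤ ‖z‖ + ‖z - l‖ := norm_sub_le _ _
  nlinarith [norm_nonneg l, norm_nonneg z, norm_nonneg (z - l), sq_nonneg (‖z‖ - ‖z - l‖)]

/-- The Gaussian weight centred at `z` is dominated by the one centred at `0` with half the
rate: `e^{-y|z-l|²} ≤ e^{y|z|²} e^{-(y/2)|l|²}` (`y ≥ 0`). [folklore] -/
theorem exp_neg_mul_norm_sub_sq_le {y : ℝ} (hy : 0 ≤ y) (z l : ℂ) :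
    rexp (-y * ‖z - l‖ ^ 2) ≤ rexp (y * ‖z‖ ^ 2) * rexp (-(y / 2) * ‖l‖ ^ 2) := by
  rw [← Real.exp_add]
  apply Real.exp_le_exp.mpr
  have := norm_sq_le_two_mul z l
  nlinarith

/-- **The shifted Gaussian factorises**: `e^{-y|z-l|²} = e^{-y|z|²} e^{-y|l|²} e^{u}` with
`u = 2y Re(z l̄)`. [folklore] -/
theorem exp_neg_mul_norm_sub_sq_eq (y : ℝ) (z l : ℂ) :
    rexp (-y * ‖z - l‖ ^ 2) =
      rexp (-y * ‖z‖ ^ 2) * rexp (-y * ‖l‖ ^ 2) * rexp (2 * y * (z * conj l).re) := by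
  rw [← Real.exp_add, ← Real.exp_add]
  congr 1
  rw [Complex.sq_norm, Complex.sq_norm, Complex.sq_norm, Complex.normSq_sub]
  ring

/-- `|2y Re(z l̄)| ≤ 2 y ‖z‖ ‖l‖` for `y ≥ 0`. [folklore] -/
theorem abs_two_mul_re_le {y : ℝ} (hy : 0 ≤ y) (z l : ℂ) :
    |2 * y * (z * conj l).re| ≤ 2 * y * ‖z‖ * ‖l‖ := by
  rw [abs_mul, abs_of_nonneg (by positivity : 0 ≤ 2 * y)]
  have h := Complex.abs_re_le_norm (z * conj l)
  rw [norm_mul, Complex.norm_conj] at h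
  calc 2 * y * |(z * conj l).re| ≤ 2 * y * (‖z‖ * ‖l‖) := by gcongr
    _ = 2 * y * ‖z‖ * ‖l‖ := by ring

/-- `2y Re(z l̄)` as a complex number: `y (z l̄ + z̄ l)`. [folklore] -/
theorem ofReal_two_mul_re (y : ℝ) (z l : ℂ) :
    ((2 * y * (z * conj l).re : ℝ) : ℂ) = y * (z * conj l + conj z * l) := by
  have h := Complex.add_conj (z * conj l)
  rw [map_mul, Complex.conj_conj] at h
  rw [h]
  push_cast
  ring

/-- `‖1/l + z/l²‖ ≤ 1 + ‖z‖` on `ℤi + ℤ` (nonzero points have norm `≥ 1`). [folklore] -/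
theorem norm_h_le (z : ℂ) (l : (ofUpperHalfPlane UpperHalfPlane.I).lattice) :
    ‖1 / (l : ℂ) + z / (l : ℂ) ^ 2‖ ≤ 1 + ‖z‖ := by
  rcases eq_or_ne (l : ℂ) 0 with hl | hl
  · rw [hl, div_zero, zero_pow two_ne_zero, div_zero, add_zero, norm_zero]
    positivity
  · have h1 := one_le_norm_of_ne_zero hl
    have h1' : 1 ≤ ‖(l : ℂ)‖ ^ 2 := by nlinarith
    refine (norm_add_le _ _).trans (add_le_add ?_ ?_)
    · rw [norm_div, norm_one]
      exact (div_le_one (by linarith)).mpr h1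
    · rw [norm_div, norm_pow]
      exact div_le_self (norm_nonneg z) h1'

/-- `‖1/l + z/l²‖ ≤ (1 + ‖z‖)/‖l‖` for `l ≠ 0` in `ℤi + ℤ`. [folklore] -/
theorem norm_h_le_div (z : ℂ) {l : (ofUpperHalfPlane UpperHalfPlane.I).lattice}
    (hl : (l : ℂ) ≠ 0) : ‖1 / (l : ℂ) + z / (l : ℂ) ^ 2‖ ≤ (1 + ‖z‖) / ‖(l : ℂ)‖ := by
  have h1 := one_le_norm_of_ne_zero hl
  have hl0 : 0 < ‖(l : ℂ)‖ := by linarith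
  calc ‖1 / (l : ℂ) + z / (l : ℂ) ^ 2‖ ≤ ‖1 / (l : ℂ)‖ + ‖z / (l : ℂ) ^ 2‖ := norm_add_le _ _
    _ = 1 / ‖(l : ℂ)‖ + ‖z‖ / ‖(l : ℂ)‖ ^ 2 := by rw [norm_div, norm_one, norm_div, norm_pow]
    _ ≤ 1 / ‖(l : ℂ)‖ + ‖z‖ / ‖(l : ℂ)‖ := by
        gcongr
        nlinarith
    _ = (1 + ‖z‖) / ‖(l : ℂ)‖ := by ring

/-- A family `e^{-y|l|²} F(l)` with `F` bounded is summable over `ℤi + ℤ` (`y > 0`). [folklore] -/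
theorem summable_exp_mul_of_norm_le {y : ℝ} (hy : 0 < y)
    {F : (ofUpperHalfPlane UpperHalfPlane.I).lattice → ℂ} {C : ℝ} (hF : ∀ l, ‖F l‖ ≤ C) :
    Summable fun l : (ofUpperHalfPlane UpperHalfPlane.I).lattice ↦
      (rexp (-y * ‖(l : ℂ)‖ ^ 2) : ℂ) * F l := by
  refine Summable.of_norm_bounded ((summable_lattice_exp_neg_mul_norm_sq hy).mul_right C)
    fun l ↦ ?_
  rw [norm_mul, Complex.norm_real, Real.norm_eq_abs, abs_of_pos (Real.exp_pos _)]
  exact mul_le_mul_of_nonneg_left (hF l) (Real.exp_pos _).le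

/-! ### The zeta part: dominated convergence -/

/-- **The Weierstrass zeta series of `ℤi + ℤ` converges absolutely**:
`∑ ‖1/(z-l) + 1/l + z/l²‖ < ∞` (terms `O(|l|⁻³)`, `PeriodPair.weierstrassZeta_bound`).
[folklore] -/
theorem summable_norm_zetaSummand (z : ℂ) :
    Summable fun l : (ofUpperHalfPlane UpperHalfPlane.I).lattice ↦
      ‖1 / (z - l) + 1 / (l : ℂ) + z / (l : ℂ) ^ 2‖ := by
  set r : ℝ := ‖z‖ + 1 with hr
  have hr0 : 0 < r := by positivity
  have hzr : ‖z‖ < r := by rw [hr]; linarith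
  have hsum : Summable fun l : (ofUpperHalfPlane UpperHalfPlane.I).lattice ↦
      2 * r ^ 2 * ‖l‖ ^ (-3 : ℝ) :=
    (ZLattice.summable_norm_rpow _ _ (by simp; norm_num)).mul_left _
  refine Summable.of_norm_bounded_eventually hsum ?_
  have hfin : (Metric.closedBall (0 : (ofUpperHalfPlane UpperHalfPlane.I).lattice)
      (2 * r)).Finite :=
    isCompact_iff_finite.mp (isCompact_closedBall _ _)
  refine Filter.mem_of_superset hfin.compl_mem_cofinite fun l hl ↦ ?_
  rw [Set.mem_setOf_eq, Real.norm_eq_abs, abs_of_nonneg (norm_nonneg _)]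
  have h2 : 2 * r ≤ ‖(l : ℂ)‖ := by
    simp only [Set.mem_compl_iff, Metric.mem_closedBall, dist_zero_right, not_le] at hl
    exact hl.le
  exact PeriodPair.weierstrassZeta_bound r hr0 z hzr l h2

/-- The Gaussian weight tends to `1`: `e^{-y|w|²} → 1` as `y → 0⁺` (in `ℂ`). [folklore] -/
theorem tendsto_ofReal_exp_neg_mul (c : ℝ) :
    Tendsto (fun y : ℝ ↦ ((rexp (-y * c) : ℝ) : ℂ)) (𝓝[>] 0) (𝓝 1) := by
  have h1 : Tendsto (fun y : ℝ ↦ rexp (-y * c)) (𝓝 0) (𝓝 1) := by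
    have hc : Continuous fun y : ℝ ↦ rexp (-y * c) := by fun_prop
    have h := hc.tendsto 0
    simp only [neg_zero, zero_mul, Real.exp_zero] at h
    exact h
  have h2 := (Complex.continuous_ofReal.tendsto 1).comp h1
  rw [Complex.ofReal_one] at h2
  exact h2.mono_left nhdsWithin_le_nhds

/-- **`∑_l e^{-y|z-l|²} (1/(z-l) + 1/l + z/l²) → ζ(z)`** as `y → 0⁺` (Tannery's theorem with the
summable bound `‖1/(z-l) + 1/l + z/l²‖`). [folklore] -/
theorem tendsto_tsum_exp_mul_zetaSummand (z : ℂ) :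
    Tendsto (fun y : ℝ ↦ ∑' l : (ofUpperHalfPlane UpperHalfPlane.I).lattice,
      (rexp (-y * ‖z - (l : ℂ)‖ ^ 2) : ℂ) * (1 / (z - l) + 1 / (l : ℂ) + z / (l : ℂ) ^ 2))
      (𝓝[>] 0) (𝓝 ((ofUpperHalfPlane UpperHalfPlane.I).weierstrassZeta z)) := by
  unfold PeriodPair.weierstrassZeta
  refine tendsto_tsum_of_dominated_convergence (summable_norm_zetaSummand z)
    (fun l ↦ ?_) ?_
  · have h := (tendsto_ofReal_exp_neg_mul (‖z - (l : ℂ)‖ ^ 2)).mul_const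
      (1 / (z - l) + 1 / (l : ℂ) + z / (l : ℂ) ^ 2)
    rwa [one_mul] at h
  · filter_upwards [self_mem_nhdsWithin] with y (hy : 0 < y)
    intro l
    rw [norm_mul, Complex.norm_real, Real.norm_eq_abs, abs_of_pos (Real.exp_pos _)]
    refine mul_le_of_le_one_left (norm_nonneg _) ?_
    rw [Real.exp_le_one_iff]
    nlinarith [sq_nonneg ‖z - (l : ℂ)‖]

/-! ### The anomaly: `∑_l e^{-y|z-l|²} (1/l + z/l²) → π z̄` -/

/-- Zeroth order: `∑ e^{-y|l|²} (1/l + z/l²) = 0`. [folklore] -/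
theorem tsum_exp_mul_h (z : ℂ) {y : ℝ} (hy : 0 < y) :
    ∑' l : (ofUpperHalfPlane UpperHalfPlane.I).lattice,
      (rexp (-y * ‖(l : ℂ)‖ ^ 2) : ℂ) * (1 / (l : ℂ) + z / (l : ℂ) ^ 2) = 0 := by
  obtain ⟨h1, h2, -, -⟩ := tsum_exp_mul_eq_zero y
  have hs1 : Summable fun l : (ofUpperHalfPlane UpperHalfPlane.I).lattice ↦
      (rexp (-y * ‖(l : ℂ)‖ ^ 2) : ℂ) * (1 / (l : ℂ)) :=
    summable_exp_mul_of_norm_le hy (C := 1) fun l ↦ by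
      rcases eq_or_ne (l : ℂ) 0 with hl | hl
      · rw [hl]; simp
      · rw [norm_div, norm_one]; exact (div_le_one (by linarith [one_le_norm_of_ne_zero hl])).mpr
          (one_le_norm_of_ne_zero hl)
  have hs2 : Summable fun l : (ofUpperHalfPlane UpperHalfPlane.I).lattice ↦
      (rexp (-y * ‖(l : ℂ)‖ ^ 2) : ℂ) * (z / (l : ℂ) ^ 2) :=
    summable_exp_mul_of_norm_le hy (C := ‖z‖) fun l ↦ by
      rcases eq_or_ne (l : ℂ) 0 with hl | hl
      · rw [hl]; simp
      · rw [norm_div, norm_pow]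
        exact div_le_self (norm_nonneg z) (by nlinarith [one_le_norm_of_ne_zero hl])
  simp_rw [mul_add]
  rw [hs1.tsum_add hs2]
  have e1 : ∑' l : (ofUpperHalfPlane UpperHalfPlane.I).lattice,
      (rexp (-y * ‖(l : ℂ)‖ ^ 2) : ℂ) * (1 / (l : ℂ)) = 0 := by
    simpa only [mul_one_div] using h1
  have e2 : ∑' l : (ofUpperHalfPlane UpperHalfPlane.I).lattice,
      (rexp (-y * ‖(l : ℂ)‖ ^ 2) : ℂ) * (z / (l : ℂ) ^ 2) = 0 := by
    have : ∀ l : (ofUpperHalfPlane UpperHalfPlane.I).lattice,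
        (rexp (-y * ‖(l : ℂ)‖ ^ 2) : ℂ) * (z / (l : ℂ) ^ 2) =
          z * ((rexp (-y * ‖(l : ℂ)‖ ^ 2) : ℂ) / (l : ℂ) ^ 2) := fun l ↦ by ring
    simp_rw [this]
    rw [tsum_mul_left, h2, mul_zero]
  rw [e1, e2, add_zero]

/-- The indicator sum `∑ e^{-y|l|²} (l/l) = ∑ e^{-y|l|²} - 1` (the term `l = 0` is missing).
[folklore] -/
theorem tsum_exp_mul_div_self {y : ℝ} (hy : 0 < y) :
    ∑' l : (ofUpperHalfPlane UpperHalfPlane.I).lattice,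
      (rexp (-y * ‖(l : ℂ)‖ ^ 2) : ℂ) * ((l : ℂ) / l) =
      ((∑' l : (ofUpperHalfPlane UpperHalfPlane.I).lattice, rexp (-y * ‖(l : ℂ)‖ ^ 2) : ℝ) : ℂ)
        - 1 := by
  have hs := summable_lattice_exp_neg_mul_norm_sq hy
  have hsC : Summable fun l : (ofUpperHalfPlane UpperHalfPlane.I).lattice ↦
      ((rexp (-y * ‖(l : ℂ)‖ ^ 2) : ℝ) : ℂ) := (Complex.hasSum_ofReal.mpr hs.hasSum).summable
  have hsI : Summable fun l : (ofUpperHalfPlane UpperHalfPlane.I).lattice ↦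
      (if l = 0 then (1 : ℂ) else 0) := summable_of_ne_finset_zero (s := {0}) (by
        intro l hl; rw [Finset.mem_singleton] at hl; exact if_neg hl)
  have key : ∀ l : (ofUpperHalfPlane UpperHalfPlane.I).lattice,
      (rexp (-y * ‖(l : ℂ)‖ ^ 2) : ℂ) * ((l : ℂ) / l) =
        (rexp (-y * ‖(l : ℂ)‖ ^ 2) : ℂ) - (if l = 0 then (1 : ℂ) else 0) := by
    intro l
    by_cases hl : l = 0
    · subst hl; simp
    · have hl' : (l : ℂ) ≠ 0 := by
        rwa [Ne, Submodule.coe_eq_zero]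
      rw [if_neg hl, div_self hl', mul_one, sub_zero]
  simp_rw [key]
  rw [hsC.tsum_sub hsI, tsum_ite_eq, Complex.ofReal_tsum]

/-- **First order**: `∑ e^{-y|l|²} · 2y Re(z l̄) · (1/l + z/l²) = y z̄ (∑ e^{-y|l|²} - 1)`
(the sums of `e^{-y|l|²} l̄/l`, `e^{-y|l|²} l̄/l²`, `e^{-y|l|²}/l` vanish by rotation). [folklore] -/
theorem tsum_exp_mul_u_mul_h (z : ℂ) {y : ℝ} (hy : 0 < y) :
    ∑' l : (ofUpperHalfPlane UpperHalfPlane.I).lattice,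
      (rexp (-y * ‖(l : ℂ)‖ ^ 2) : ℂ) * ((2 * y * (z * conj (l : ℂ)).re : ℝ) : ℂ) *
        (1 / (l : ℂ) + z / (l : ℂ) ^ 2) =
      y * conj z *
        (((∑' l : (ofUpperHalfPlane UpperHalfPlane.I).lattice, rexp (-y * ‖(l : ℂ)‖ ^ 2) : ℝ) : ℂ)
          - 1) := by
  obtain ⟨h1, -, h3, h4⟩ := tsum_exp_mul_eq_zero y
  -- pointwise algebra
  have key : ∀ l : (ofUpperHalfPlane UpperHalfPlane.I).lattice,
      (rexp (-y * ‖(l : ℂ)‖ ^ 2) : ℂ) * ((2 * y * (z * conj (l : ℂ)).re : ℝ) : ℂ) *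
        (1 / (l : ℂ) + z / (l : ℂ) ^ 2) =
      (y * z) * ((rexp (-y * ‖(l : ℂ)‖ ^ 2) : ℂ) * conj (l : ℂ) / l) +
      (y * z ^ 2) * ((rexp (-y * ‖(l : ℂ)‖ ^ 2) : ℂ) * conj (l : ℂ) / (l : ℂ) ^ 2) +
      (y * conj z) * ((rexp (-y * ‖(l : ℂ)‖ ^ 2) : ℂ) * ((l : ℂ) / l)) +
      (y * (z * conj z)) * ((rexp (-y * ‖(l : ℂ)‖ ^ 2) : ℂ) / l) := by
    intro l
    rw [ofReal_two_mul_re]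
    rcases eq_or_ne (l : ℂ) 0 with hl | hl
    · rw [hl]; simp
    · field_simp
      ring
  simp_rw [key]
  -- summability of the four families
  have hb : ∀ l : (ofUpperHalfPlane UpperHalfPlane.I).lattice, ‖conj (l : ℂ) / l‖ ≤ 1 := by
    intro l
    rcases eq_or_ne (l : ℂ) 0 with hl | hl
    · rw [hl]; simp
    · rw [norm_div, Complex.norm_conj, div_self (norm_ne_zero_iff.mpr hl)]
  have hb2 : ∀ l : (ofUpperHalfPlane UpperHalfPlane.I).lattice,
      ‖conj (l : ℂ) / (l : ℂ) ^ 2‖ ≤ 1 := by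
    intro l
    rcases eq_or_ne (l : ℂ) 0 with hl | hl
    · rw [hl]; simp
    · have h1l := one_le_norm_of_ne_zero hl
      rw [norm_div, Complex.norm_conj, norm_pow, div_le_one (by positivity)]
      nlinarith
  have hb3 : ∀ l : (ofUpperHalfPlane UpperHalfPlane.I).lattice, ‖(l : ℂ) / l‖ ≤ 1 := by
    intro l
    rcases eq_or_ne (l : ℂ) 0 with hl | hl
    · rw [hl]; simp
    · rw [div_self hl, norm_one]
  have hb4 : ∀ l : (ofUpperHalfPlane UpperHalfPlane.I).lattice, ‖1 / (l : ℂ)‖ ≤ 1 := by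
    intro l
    rcases eq_or_ne (l : ℂ) 0 with hl | hl
    · rw [hl]; simp
    · rw [norm_div, norm_one]
      exact (div_le_one (by linarith [one_le_norm_of_ne_zero hl])).mpr
        (one_le_norm_of_ne_zero hl)
  have hs1 := (summable_exp_mul_of_norm_le hy hb).mul_left (y * z)
  have hs2 := (summable_exp_mul_of_norm_le hy hb2).mul_left (y * z ^ 2)
  have hs3 := (summable_exp_mul_of_norm_le hy hb3).mul_left (y * conj z)
  have hs4 := (summable_exp_mul_of_norm_le hy hb4).mul_left (y * (z * conj z))
  simp only [mul_div_assoc] at h3 h4 ⊢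
  have hs4' : Summable fun l : (ofUpperHalfPlane UpperHalfPlane.I).lattice ↦
      (y * (z * conj z)) * ((rexp (-y * ‖(l : ℂ)‖ ^ 2) : ℂ) / (l : ℂ)) := by
    simpa only [mul_one_div] using hs4
  rw [((hs1.add hs2).add hs3).tsum_add hs4', (hs1.add hs2).tsum_add hs3, hs1.tsum_add hs2,
    tsum_mul_left, tsum_mul_left, tsum_mul_left, tsum_mul_left, h3, h4, h1,
    tsum_exp_mul_div_self hy]
  ring


/-- **The remainder term**: for `0 < y ≤ 1` and `l ∈ ℤi + ℤ`, with `u = 2y Re(z l̄)`,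
`‖e^{-y|l|²} (e^u - 1 - u) (1/l + z/l²)‖ ≤ K₀ · y√y · e^{-(y/4)|l|²}`,
`K₀ = 8‖z‖²(1 + ‖z‖) e^{2‖z‖²}`. [folklore] -/
theorem norm_rem_le (z : ℂ) {y : ℝ} (hy : 0 < y) (hy1 : y ≤ 1)
    (l : (ofUpperHalfPlane UpperHalfPlane.I).lattice) :
    ‖(rexp (-y * ‖(l : ℂ)‖ ^ 2) : ℂ) *
        ((rexp (2 * y * (z * conj (l : ℂ)).re) - 1 - 2 * y * (z * conj (l : ℂ)).re : ℝ) : ℂ) *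
        (1 / (l : ℂ) + z / (l : ℂ) ^ 2)‖ ≤
      8 * ‖z‖ ^ 2 * (1 + ‖z‖) * rexp (2 * ‖z‖ ^ 2) * (y * Real.sqrt y) *
        rexp (-(y / 4) * ‖(l : ℂ)‖ ^ 2) := by
  have hsy : 0 < Real.sqrt y := Real.sqrt_pos.mpr hy
  rcases eq_or_ne (l : ℂ) 0 with hl | hl
  · rw [hl, div_zero, zero_pow two_ne_zero, div_zero, add_zero, mul_zero, norm_zero]
    positivity
  set n : ℝ := ‖(l : ℂ)‖ with hn
  set u : ℝ := 2 * y * (z * conj (l : ℂ)).re with hu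
  have hn1 : 1 ≤ n := one_le_norm_of_ne_zero hl
  have hn0 : 0 < n := by linarith
  have hρ0 : 0 ≤ rexp u - 1 - u := exp_sub_one_sub_nonneg u
  have hρ : rexp u - 1 - u ≤ u ^ 2 * rexp |u| := exp_sub_one_sub_le u
  have hua : |u| ≤ 2 * y * ‖z‖ * n := abs_two_mul_re_le hy.le z l
  have hu2 : u ^ 2 ≤ (2 * y * ‖z‖ * n) ^ 2 := by
    rw [← sq_abs u]
    exact pow_le_pow_left₀ (abs_nonneg u) hua 2
  have hkey : 2 * y * ‖z‖ * n ≤ y / 2 * n ^ 2 + 2 * ‖z‖ ^ 2 := by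
    nlinarith [sq_nonneg (n - 2 * ‖z‖), norm_nonneg z, sq_nonneg ‖z‖, hy.le]
  have hexp : rexp |u| ≤ rexp (y / 2 * n ^ 2) * rexp (2 * ‖z‖ ^ 2) := by
    rw [← Real.exp_add]
    exact Real.exp_le_exp.mpr (hua.trans hkey)
  have hh : ‖1 / (l : ℂ) + z / (l : ℂ) ^ 2‖ ≤ (1 + ‖z‖) / n := norm_h_le_div z hl
  have hnexp : n * rexp (-(y / 4) * n ^ 2) ≤ 2 / Real.sqrt y :=
    mul_exp_neg_le_two_div_sqrt hy hn0.le
  -- the exponentials combine: `e^{-y n²} e^{(y/2) n²} = e^{-(y/4)n²} e^{-(y/4)n²}`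
  have hcomb : rexp (-y * n ^ 2) * rexp (y / 2 * n ^ 2) =
      rexp (-(y / 4) * n ^ 2) * rexp (-(y / 4) * n ^ 2) := by
    rw [← Real.exp_add, ← Real.exp_add]; congr 1; ring
  rw [norm_mul, norm_mul, Complex.norm_real, Complex.norm_real, Real.norm_eq_abs,
    Real.norm_eq_abs, abs_of_pos (Real.exp_pos _), abs_of_nonneg hρ0]
  calc rexp (-y * n ^ 2) * (rexp u - 1 - u) * ‖1 / (l : ℂ) + z / (l : ℂ) ^ 2‖
      ≤ rexp (-y * n ^ 2) * ((2 * y * ‖z‖ * n) ^ 2 * (rexp (y / 2 * n ^ 2) * rexp (2 * ‖z‖ ^ 2)))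
          * ((1 + ‖z‖) / n) := by
        gcongr
        exact hρ.trans (mul_le_mul hu2 hexp (Real.exp_pos _).le (sq_nonneg _))
    _ = 4 * ‖z‖ ^ 2 * (1 + ‖z‖) * rexp (2 * ‖z‖ ^ 2) * y ^ 2 *
          (rexp (-y * n ^ 2) * rexp (y / 2 * n ^ 2)) * n := by
        field_simp
        ring
    _ = 4 * ‖z‖ ^ 2 * (1 + ‖z‖) * rexp (2 * ‖z‖ ^ 2) * y ^ 2 * rexp (-(y / 4) * n ^ 2) *
          (n * rexp (-(y / 4) * n ^ 2)) := by
        rw [hcomb]; ring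
    _ ≤ 4 * ‖z‖ ^ 2 * (1 + ‖z‖) * rexp (2 * ‖z‖ ^ 2) * y ^ 2 * rexp (-(y / 4) * n ^ 2) *
          (2 / Real.sqrt y) := by
        gcongr
    _ = 8 * ‖z‖ ^ 2 * (1 + ‖z‖) * rexp (2 * ‖z‖ ^ 2) * (y * Real.sqrt y) *
          rexp (-(y / 4) * n ^ 2) := by
        field_simp
        rw [Real.sq_sqrt hy.le]
        ring

/-- The remainder sum is `O(√y)`: `‖∑_l e^{-y|l|²} ρ_l h(l)‖ ≤ K₀ y√y ∑_l e^{-(y/4)|l|²}` for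
`0 < y ≤ 1`. [folklore] -/
theorem norm_tsum_rem_le (z : ℂ) {y : ℝ} (hy : 0 < y) (hy1 : y ≤ 1) :
    ‖∑' l : (ofUpperHalfPlane UpperHalfPlane.I).lattice, (rexp (-y * ‖(l : ℂ)‖ ^ 2) : ℂ) *
        ((rexp (2 * y * (z * conj (l : ℂ)).re) - 1 - 2 * y * (z * conj (l : ℂ)).re : ℝ) : ℂ) *
        (1 / (l : ℂ) + z / (l : ℂ) ^ 2)‖ ≤
      8 * ‖z‖ ^ 2 * (1 + ‖z‖) * rexp (2 * ‖z‖ ^ 2) * (y * Real.sqrt y) *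
        ∑' l : (ofUpperHalfPlane UpperHalfPlane.I).lattice, rexp (-(y / 4) * ‖(l : ℂ)‖ ^ 2) := by
  have h4 : 0 < y / 4 := by positivity
  exact tsum_of_norm_bounded ((summable_lattice_exp_neg_mul_norm_sq h4).hasSum.mul_left _)
    (norm_rem_le z hy hy1)

/-- The remainder family is summable (`0 < y ≤ 1`). [folklore] -/
theorem summable_rem (z : ℂ) {y : ℝ} (hy : 0 < y) (hy1 : y ≤ 1) :
    Summable fun l : (ofUpperHalfPlane UpperHalfPlane.I).lattice ↦
      (rexp (-y * ‖(l : ℂ)‖ ^ 2) : ℂ) *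
        ((rexp (2 * y * (z * conj (l : ℂ)).re) - 1 - 2 * y * (z * conj (l : ℂ)).re : ℝ) : ℂ) *
        (1 / (l : ℂ) + z / (l : ℂ) ^ 2) := by
  have h4 : 0 < y / 4 := by positivity
  exact Summable.of_norm_bounded ((summable_lattice_exp_neg_mul_norm_sq h4).mul_left _)
    (norm_rem_le z hy hy1)

/-- **The remainder sum tends to `0`** as `y → 0⁺`. [folklore] -/
theorem tendsto_tsum_rem (z : ℂ) :
    Tendsto (fun y : ℝ ↦ ∑' l : (ofUpperHalfPlane UpperHalfPlane.I).lattice,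
      (rexp (-y * ‖(l : ℂ)‖ ^ 2) : ℂ) *
        ((rexp (2 * y * (z * conj (l : ℂ)).re) - 1 - 2 * y * (z * conj (l : ℂ)).re : ℝ) : ℂ) *
        (1 / (l : ℂ) + z / (l : ℂ) ^ 2)) (𝓝[>] 0) (𝓝 0) := by
  set K : ℝ := 8 * ‖z‖ ^ 2 * (1 + ‖z‖) * rexp (2 * ‖z‖ ^ 2) with hK
  -- the bound `K y√y N(y/4) = K √y · 4 · ((y/4) N(y/4))` tends to `0`
  have hq : Tendsto (fun y : ℝ ↦ (y / 4) *
      ∑' l : (ofUpperHalfPlane UpperHalfPlane.I).lattice, rexp (-(y / 4) * ‖(l : ℂ)‖ ^ 2))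
      (𝓝[>] 0) (𝓝 π) :=
    tendsto_mul_tsum_exp_neg_mul_norm_sq.comp (tendsto_div_const_nhdsGT_zero four_pos)
  have hsqrt : Tendsto (fun y : ℝ ↦ Real.sqrt y) (𝓝[>] 0) (𝓝 0) := by
    have h := Real.continuous_sqrt.tendsto 0
    rw [Real.sqrt_zero] at h
    exact h.mono_left nhdsWithin_le_nhds
  have hbound : Tendsto (fun y : ℝ ↦ K * Real.sqrt y * (4 * ((y / 4) *
      ∑' l : (ofUpperHalfPlane UpperHalfPlane.I).lattice,
        rexp (-(y / 4) * ‖(l : ℂ)‖ ^ 2)))) (𝓝[>] 0) (𝓝 (K * 0 * (4 * π))) :=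
    ((hsqrt.const_mul K).mul (hq.const_mul 4))
  rw [mul_zero, zero_mul] at hbound
  refine squeeze_zero_norm' ?_ hbound
  filter_upwards [Ioc_mem_nhdsGT (zero_lt_one' ℝ)] with y hy
  refine (norm_tsum_rem_le z hy.1 hy.2).trans (le_of_eq ?_)
  ring

/-- **The anomaly**: `∑_l e^{-y|z-l|²} (1/l + z/l²) → π z̄` as `y → 0⁺`. [folklore] -/
theorem tendsto_tsum_exp_mul_h (z : ℂ) :
    Tendsto (fun y : ℝ ↦ ∑' l : (ofUpperHalfPlane UpperHalfPlane.I).lattice,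
      (rexp (-y * ‖z - (l : ℂ)‖ ^ 2) : ℂ) * (1 / (l : ℂ) + z / (l : ℂ) ^ 2))
      (𝓝[>] 0) (𝓝 (π * conj z)) := by
  -- the limit of the main term `e^{-y|z|²} (y z̄ (N(y) - 1) + Rem(y))`
  have hN := tendsto_mul_tsum_exp_neg_mul_norm_sq
  have hN' : Tendsto (fun y : ℝ ↦ ((y * ∑' l : (ofUpperHalfPlane UpperHalfPlane.I).lattice,
      rexp (-y * ‖(l : ℂ)‖ ^ 2) : ℝ) : ℂ) - y) (𝓝[>] 0) (𝓝 ((π : ℂ) - 0)) := by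
    refine ((Complex.continuous_ofReal.tendsto π).comp hN).sub ?_
    have h := (Complex.continuous_ofReal.tendsto 0)
    rw [Complex.ofReal_zero] at h
    exact h.mono_left nhdsWithin_le_nhds
  rw [sub_zero] at hN'
  have hE0 := tendsto_ofReal_exp_neg_mul (‖z‖ ^ 2)
  have hlim : Tendsto (fun y : ℝ ↦ ((rexp (-y * ‖z‖ ^ 2) : ℝ) : ℂ) *
      (conj z * (((y * ∑' l : (ofUpperHalfPlane UpperHalfPlane.I).lattice,
        rexp (-y * ‖(l : ℂ)‖ ^ 2) : ℝ) : ℂ) - y) +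
      ∑' l : (ofUpperHalfPlane UpperHalfPlane.I).lattice, (rexp (-y * ‖(l : ℂ)‖ ^ 2) : ℂ) *
        ((rexp (2 * y * (z * conj (l : ℂ)).re) - 1 - 2 * y * (z * conj (l : ℂ)).re : ℝ) : ℂ) *
        (1 / (l : ℂ) + z / (l : ℂ) ^ 2))) (𝓝[>] 0) (𝓝 (1 * (conj z * π + 0))) :=
    hE0.mul ((hN'.const_mul (conj z)).add (tendsto_tsum_rem z))
  rw [one_mul, add_zero, mul_comm (conj z)] at hlim
  refine hlim.congr' ?_
  filter_upwards [Ioc_mem_nhdsGT (zero_lt_one' ℝ)] with y hy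
  have hy0 : 0 < y := hy.1
  -- summability of the three families
  have hsA : Summable fun l : (ofUpperHalfPlane UpperHalfPlane.I).lattice ↦
      (rexp (-y * ‖(l : ℂ)‖ ^ 2) : ℂ) * (1 / (l : ℂ) + z / (l : ℂ) ^ 2) :=
    summable_exp_mul_of_norm_le hy0 (norm_h_le z)
  have hsB : Summable fun l : (ofUpperHalfPlane UpperHalfPlane.I).lattice ↦
      (rexp (-y * ‖(l : ℂ)‖ ^ 2) : ℂ) * (((2 * y * (z * conj (l : ℂ)).re : ℝ) : ℂ) *
        (1 / (l : ℂ) + z / (l : ℂ) ^ 2)) := by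
    refine summable_exp_mul_of_norm_le hy0 (C := 2 * y * ‖z‖ * (1 + ‖z‖)) fun l ↦ ?_
    rcases eq_or_ne (l : ℂ) 0 with hl | hl
    · rw [hl, div_zero, zero_pow two_ne_zero, div_zero, add_zero, mul_zero, norm_zero]
      positivity
    · have hn0 : 0 < ‖(l : ℂ)‖ := by linarith [one_le_norm_of_ne_zero hl]
      rw [norm_mul, Complex.norm_real, Real.norm_eq_abs]
      calc |2 * y * (z * conj (l : ℂ)).re| * ‖1 / (l : ℂ) + z / (l : ℂ) ^ 2‖
          ≤ (2 * y * ‖z‖ * ‖(l : ℂ)‖) * ((1 + ‖z‖) / ‖(l : ℂ)‖) :=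
            mul_le_mul (abs_two_mul_re_le hy0.le z l) (norm_h_le_div z hl) (norm_nonneg _)
              (by positivity)
        _ = 2 * y * ‖z‖ * (1 + ‖z‖) := by field_simp
  have hsC := summable_rem z hy0 hy.2
  -- pointwise decomposition of the shifted Gaussian
  have key : ∀ l : (ofUpperHalfPlane UpperHalfPlane.I).lattice,
      (rexp (-y * ‖z - (l : ℂ)‖ ^ 2) : ℂ) * (1 / (l : ℂ) + z / (l : ℂ) ^ 2) =
      ((rexp (-y * ‖z‖ ^ 2) : ℝ) : ℂ) *
        ((rexp (-y * ‖(l : ℂ)‖ ^ 2) : ℂ) * (1 / (l : ℂ) + z / (l : ℂ) ^ 2) +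
         (rexp (-y * ‖(l : ℂ)‖ ^ 2) : ℂ) * (((2 * y * (z * conj (l : ℂ)).re : ℝ) : ℂ) *
           (1 / (l : ℂ) + z / (l : ℂ) ^ 2)) +
         (rexp (-y * ‖(l : ℂ)‖ ^ 2) : ℂ) *
           ((rexp (2 * y * (z * conj (l : ℂ)).re) - 1 - 2 * y * (z * conj (l : ℂ)).re : ℝ) : ℂ) *
           (1 / (l : ℂ) + z / (l : ℂ) ^ 2)) := by
    intro l
    rw [exp_neg_mul_norm_sub_sq_eq y z l]
    push_cast
    ring
  simp_rw [key]
  rw [tsum_mul_left, (hsA.add hsB).tsum_add hsC, hsA.tsum_add hsB, tsum_exp_mul_h z hy0,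
    zero_add]
  congr 2
  -- the first-order term
  have hB := tsum_exp_mul_u_mul_h z hy0
  simp only [mul_assoc] at hB ⊢
  rw [hB]
  push_cast
  ring

/-! ### The main theorem -/

/-- **Kronecker's limit formula of weight one on `ℤi + ℤ`, Gaussian regularisation.** For
every `z ∈ ℂ`,

  `lim_{y → 0⁺} ∑_{l ∈ ℤi+ℤ} e^{-y|z-l|²} / (z - l) = ζ(z) - π z̄`,

where `ζ` is the Weierstrass zeta function of the lattice `ℤi + ℤ`
(`PeriodPair.weierstrassZeta`; for `z` in the lattice both sides carry the junk value of the
pole term). The Gauss-damped sum centred at `z` is how the Dirichlet series of a weight-one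
Hecke character of `ℚ(i)` is summed at `s = 1` (`GaussianThetaLValueOne`); the anomaly `-π z̄`
is the non-holomorphic part of `E₁*(z) = ζ(z) - π z̄ / covol` (Weil, *Elliptic functions
according to Eisenstein and Kronecker*, VIII; Birch–Swinnerton-Dyer 1965, §3). [folklore] -/
theorem tendsto_tsum_exp_div_sub (z : ℂ) :
    Tendsto (fun y : ℝ ↦ ∑' l : (ofUpperHalfPlane UpperHalfPlane.I).lattice,
      (rexp (-y * ‖z - (l : ℂ)‖ ^ 2) : ℂ) / (z - l)) (𝓝[>] 0)
      (𝓝 ((ofUpperHalfPlane UpperHalfPlane.I).weierstrassZeta z - π * conj z)) := by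
  refine ((tendsto_tsum_exp_mul_zetaSummand z).sub (tendsto_tsum_exp_mul_h z)).congr' ?_
  filter_upwards [self_mem_nhdsWithin] with y (hy : 0 < y)
  have hsg : Summable fun l : (ofUpperHalfPlane UpperHalfPlane.I).lattice ↦
      (rexp (-y * ‖z - (l : ℂ)‖ ^ 2) : ℂ) * (1 / (z - l) + 1 / (l : ℂ) + z / (l : ℂ) ^ 2) := by
    refine Summable.of_norm_bounded (summable_norm_zetaSummand z) fun l ↦ ?_
    rw [norm_mul, Complex.norm_real, Real.norm_eq_abs, abs_of_pos (Real.exp_pos _)]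
    refine mul_le_of_le_one_left (norm_nonneg _) ?_
    rw [Real.exp_le_one_iff]
    nlinarith [sq_nonneg ‖z - (l : ℂ)‖]
  have hsh : Summable fun l : (ofUpperHalfPlane UpperHalfPlane.I).lattice ↦
      (rexp (-y * ‖z - (l : ℂ)‖ ^ 2) : ℂ) * (1 / (l : ℂ) + z / (l : ℂ) ^ 2) := by
    refine Summable.of_norm_bounded
      (((summable_lattice_exp_neg_mul_norm_sq (by positivity : 0 < y / 2)).mul_left
        (rexp (y * ‖z‖ ^ 2))).mul_right (1 + ‖z‖)) fun l ↦ ?_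
    rw [norm_mul, Complex.norm_real, Real.norm_eq_abs, abs_of_pos (Real.exp_pos _)]
    exact mul_le_mul (exp_neg_mul_norm_sub_sq_le hy.le z l) (norm_h_le z l) (norm_nonneg _)
      (by positivity)
  rw [← hsg.tsum_sub hsh]
  refine tsum_congr fun l ↦ ?_
  ring

end GaussianLattice

end Literature.NumberTheory.EllipticCurves

end
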